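import Summits.QuantumFields.BalabanUV.Beta.GAN24.ContactOneGaugeCellBound
import Summits.QuantumFields.BalabanUV.Beta.GAN24.StaircaseFaces

/-!
# `BalabanUV.Beta.GAN24.ContactCellRefine` — binder row G-an2-4 / (CONV-C), the row owner's CONTACT-TERM ROUTE, **CT-4c** of the owner's
# `gen19/CT4-DESIGN-v0.md` §3 («`ContactCellRefine` — the cell-refinement bookkeeping of §2 (a fine′ sum as a sum over `Lc`-cells of tower n's lattice)
# + the differenced terms as an inequality schema over abstract envelopes (like leaf-02's `abs_cell_le'`): M-sized, generic d. Owner or leaf-02»), PART 1: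
# **READING THE SHORTER TOWER ON THE TALLER TOWER'S FINE′ LATTICE, THE THREE-FACTOR SPLIT «EXACTLY ONE DIFFERENCED INGREDIENT» OF A MAXWELL
# PAIRING, AND THE JUMP COUNT OF A STAIRCASE AGAINST TWO SMOOTH FACTORS.**

NOT IN PRINT; OUR BOOKKEEPING (G-an2-4 formalisation swarm, leaf prover `b2b-balaban-gan24-formalise-leaf-02`, gen 50; «MINE (CT-4c)» journal
`CLAIMS.log` l.35439; refuter CHECK #60 (v) «CT-4c M (pure bookkeeping) → leaf-02 ∕ owner»).  HONEST FRAMING (cell contract, verbatim): «discharging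
`BetaPertH` makes Bałaban's UV stability UNCONDITIONAL — a real constructive-QFT result; it is NOT the continuum limit and NOT the Clay problem.»  HONEST
DEPENDENCY (verbatim): «continuum YM on T⁴ ⇐ BetaPertH ∧ nine spine estimates (0/9 proved); BetaPertH ⇐ (D1) ∧ (D4) ∧ CAP+tail; G-an2-4 gates asym,
D1 and NE2/3/4.»

SETTING (CT4-DESIGN §2).  The two towers are compared ON THE TALLER TOWER'S FINE′ LATTICE `Site (d+1)`: the shorter tower (blocking `N`) is read through the
cell map `quo L` (`L` = the extra blocking factor, `N′ = L·N`), so a tower-`k` quantity `X` appears as the cell-constant `X ∘ quo L` and its block envelope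
`e^{−κ₀‖quo N c − z‖∞}` becomes `e^{−κ₀‖quo N′ x − z‖∞}` (`quo N ∘ quo L = quo N′`, the owner's `StaircaseFaces.quo_quo`).  After my lineage's `cell_eq`
(`ContactOneGaugeCell`, p272832) every contact cell is a pair of MAXWELL PAIRINGS `Σ'_u Σ_κ w κ u·T κ u·M κ u` (gauge weight × partner × tent), so the
comparison is made pairing by pairing.

WHAT (generic `d`; 0 `def`, 0 cited fact, 0 `def … : Prop`, 0 sorry; [folklore] Riemann-sum ∕ face bookkeeping over tree lemmas BY NAME).
* §1 READING: `units_refine` — `(N′^{d+1})⁻¹·Σ'_x g (quo L x) = (N^{d+1})⁻¹·Σ'_c g c` (leaf-04's `TaylorBlockSum.tsum_comp_quo`: each cell has `L^{d+1}`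
  points; the count's `L^{d+1}` cancels the Riemann prefactor EXACTLY — the design's attack (iii), no power of `Lc` per level); `quo_quo'`.
* §2 **`abs_refine3_le`** — «EXACTLY ONE DIFFERENCED INGREDIENT»: the split WITH THE WEIGHT LAST,
  `W′𝒯′ℳ′ − W̃𝒯̃ℳ̃ = W′(𝒯′ − 𝒯̃)ℳ′ + W′𝒯̃(ℳ′ − ℳ̃) + (W′ − W̃)𝒯̃ℳ̃` (`X̃ := X ∘ quo L`), counted by three of my lineage's
  `ContactOneGaugeCellBound.abs_tsum_weight_mul_mul_le` (p271451): fine′ envelopes of `W′, ℳ′`, tower-`k` envelopes of `W, 𝒯, ℳ`, and POINTWISE differenced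
  letters `|𝒯′ κ x − 𝒯 κ (quo L x)| ≤ ε₁·e^{−κ₀‖quo N′ x − z₁‖∞}`, `|ℳ′ − ℳ̃| ≤ ε₃·(…z₃)`, `|W′ − W̃| ≤ εw·(…z₀)` give
  `|(N′^{d+1})⁻¹·Σ'_x Σ_κ W′𝒯′ℳ′ − (N^{d+1})⁻¹·Σ'_c Σ_κ W𝒯ℳ| ≤ (d+1)·(Ew·ε₁·E₃ + Ew·E₁·ε₃ + εw·E₁·E₃)·Zl(d+1)(κ₀∕(4(d+1)))·e^{−(κ₀∕12)(‖z₁−z₀‖∞+‖z₃−z₀‖∞)}`.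
  Consumes (β) (partners: (N1′) + (N1-Cauchy)) as `ε₁`, (γ) (tents: gan24-p2's `ContactTentRefine.exists_tent_refine_all_three`, p291741) as `ε₃`, and
  (α)+(δ) (the gauge weight: CT-4b summed over the staircase) as `εw` — for SITE weights; the TIP ∕ MIDPOINT weights of `cell_eq` need in addition the
  realignment of PART 2 (`ContactCellRefineGrad`).
* §3 **THE JUMP COUNT** (one lattice, blocking `N`): a function `g ∘ blk P` block-constant at a scale `P ∣ N` jumps only across the `P`-faces
  (`StaircaseFaces.blk_add_unitVec_of_not_dvd`), which carry exactly `P⁻¹` of the mass of a block-scale weight (`StaircaseFaces.tsum_ite_dvd_eq`):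
  `abs_tsum_mul_jump_blk_le` — `|Σ'_u Σ_κ Φ κ u·(g(blk P (u+e_κ)) − g(blk P u))| ≤ (d+1)·2e^{κ₀}·A·B·P⁻¹·N^{d+1}·Zl·e^{−(κ₀∕12)spread}` for a factor
  `|Φ κ u| ≤ A·E_{z₁}(u)·E_{z₃}(u)` (the product of the two smooth factors, or of one differenced letter and one smooth factor) and `|g (blk P u)| ≤ B·E_{z₀}(u)`;
  `abs_tsum_mul_jump_staircase_le` — the same for a STAIRCASE `g = Σ_{s<k+1} G s ∘ blk (P s)` with per-scale envelopes `a s`: weight `Σ_s a s·(P s)⁻¹`.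
  With the consumer's unit amplitudes `a s = α·Lc^s∕N` at `P s = Lc^s` this is `α·(k+1)∕N` — the tip-weight REALIGNMENT of PART 2 is relatively
  `O((k+1)∕N)`; at `P s = L·Lc^s` (the shorter tower's staircase read on fine′) it is the GRADIENT-SLOT face term of PART 2, `(k+1)·ε` — ONE LOG, absorbed by
  any θS above the letters' rate exactly like the design's (δ) (refuter CHECK #60 (ii)).
Spelling: sites `Site (d+1) = Fin (d+1) → ℤ`; `B6BondElimination.unitVec` (the cells' spelling; `= AffineAveraging.unitVec`, leaf-02's
`ContactOneGaugeCellAlgebra.affine_unitVec_eq`, re-derived inline where the owner's `StaircaseFaces` lemmas are invoked); `AveragingContours.blk = LatticeForm.quo`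
by `rfl`.  Discharges NOTHING of hSdev by itself (CT-4e composes (α)–(ε)); 0 wall binders; NEVER «G-an2-4 closed» as (CONV-C); NOT D1, NOT BetaPertH,
NOT continuum, NOT Clay.
-/

noncomputable section

open Finset
open scoped BigOperators
open Literature.MathematicalPhysics.QuantumFieldTheory
open Literature.MathematicalPhysics.QuantumFieldTheory.LatticeForm (quo)
open Literature.MathematicalPhysics.QuantumFieldTheory.Balaban1983to89
open Literature.MathematicalPhysics.QuantumFieldTheory.Balaban1983to89.Beta
open B4ContourShift (supNorm supNorm_nonneg)
open ExpKernelCalculus (Zl Zl_nonneg)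
open AffineAveraging (Form0 Form1 Site box toSite)
open AveragingContours (blk)
open B6BondElimination (unitVec unitVec_apply)
open Summit.QuantumFields.BalabanUV.Beta.GAN24.EnvelopeBlockSum (env_le_one)
open Summit.QuantumFields.BalabanUV.Beta.GAN24.StaircaseFaces (blk_add_unitVec_of_not_dvd tsum_ite_dvd_eq quo_quo quo_zsmul_add_toSite_of_dvd
  env_add_unitVec_le)
open Summit.QuantumFields.BalabanUV.Beta.GAN24.ContactOneGaugeCellBound (tsum_env3_le abs_tsum_weight_mul_mul_le)
open Summit.QuantumFields.BalabanUV.Beta.GAN24.TaylorBlockSum (tsum_comp_quo summable_comp_quo)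

namespace Summit.QuantumFields.BalabanUV.Beta.GAN24.ContactCellRefine

variable {d : ℕ}

/-! ## §1 Reading the shorter tower on the fine′ lattice -/

section Reading

/-- [folklore] The labels compose: `quo N (quo L x) = quo N′ x` for `N′ = L·N` (the owner's `StaircaseFaces.quo_quo`) — a tower-`k` block envelope read
through the cell map is the fine′ block envelope at blocking `N′`. -/
theorem quo_quo' {L N N' : ℕ} (hN' : N' = L * N) (x : Site (d + 1)) : quo N (quo L x) = quo N' x := by
  rw [hN']
  exact quo_quo L N x

/-- [folklore] **READING A TOWER-`k` LATTICE SUM ON THE FINE′ LATTICE, NORMALISED**: each cell has exactly `L^{d+1}` points (leaf-04's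
`TaylorBlockSum.tsum_comp_quo`), so with `N′ = L·N` the Riemann prefactors match EXACTLY:
`(N′^{d+1})⁻¹·Σ'_x g (quo L x) = (N^{d+1})⁻¹·Σ'_c g c` — no power of `L` is lost or gained per level (CT4-DESIGN §4 attack (iii)). -/
theorem units_refine {L N N' : ℕ} (hL : 1 ≤ L) (hN : 1 ≤ N) (hN' : N' = L * N) {g : Site (d + 1) → ℝ} (hg : Summable g) :
    ((N' : ℝ) ^ (d + 1))⁻¹ * ∑' x : Site (d + 1), g (quo L x) = ((N : ℝ) ^ (d + 1))⁻¹ * ∑' c : Site (d + 1), g c := by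
  haveI : NeZero L := ⟨by omega⟩
  have hL0 : (L : ℝ) ≠ 0 := by exact_mod_cast (show L ≠ 0 by omega)
  have hN0 : (N : ℝ) ≠ 0 := by exact_mod_cast (show N ≠ 0 by omega)
  rw [tsum_comp_quo (N := L) hg, hN']
  push_cast
  rw [mul_pow, mul_inv, mul_comm (((L : ℝ) ^ (d + 1))⁻¹), mul_assoc, inv_mul_cancel_left₀ (pow_ne_zero _ hL0)]

/-- [folklore] The un-normalised reading: `Σ'_x g (quo L x) = L^{d+1}·Σ'_c g c` (leaf-04's `tsum_comp_quo`, restated in the `1 ≤ L` currency). -/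
theorem tsum_comp_quo' {L : ℕ} (hL : 1 ≤ L) {g : Site (d + 1) → ℝ} (hg : Summable g) :
    ∑' x : Site (d + 1), g (quo L x) = (L : ℝ) ^ (d + 1) * ∑' c : Site (d + 1), g c := by
  haveI : NeZero L := ⟨by omega⟩
  exact tsum_comp_quo (N := L) hg

/-- [folklore] … and its summability. -/
theorem summable_comp_quo' {L : ℕ} (hL : 1 ≤ L) {g : Site (d + 1) → ℝ} (hg : Summable g) :
    Summable fun x : Site (d + 1) => g (quo L x) := by
  haveI : NeZero L := ⟨by omega⟩
  exact summable_comp_quo (N := L) hg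

end Reading

/-! ## §2 «Exactly one differenced ingredient»: the three-factor split of a Maxwell pairing -/

section Refine3

variable {L N N' : ℕ} {κ₀ : ℝ} {W' T' M' W T M : Form1 (d + 1) ℝ} {z₀ z₁ z₃ : Site (d + 1)} {Ew E₁ E₃ εw ε₁ ε₃ : ℝ}

/-- NOT IN PRINT; OUR BOOKKEEPING.  **THE TWO-TOWER DIFFERENCE OF A MAXWELL PAIRING WITH POINTWISE LETTERS** (CT4-DESIGN §2 «by MULTILINEARITY
the difference is a sum of terms each carrying EXACTLY ONE differenced ingredient», the weight differenced LAST): fine′ forms `W′ T′ M′` (blocking `N′ = L·N`)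
against tower-`k` forms `W T M` read through `quo L`, with block envelopes (centres `z₀ z₁ z₃`, one rate `κ₀`) and pointwise differenced letters `εw ε₁ ε₃`
on the fine′ lattice ⟹ both pairings are summable and
`|(N′^{d+1})⁻¹·Σ'_x Σ_κ W′T′M′ − (N^{d+1})⁻¹·Σ'_c Σ_κ W T M| ≤ (d+1)·(Ew·ε₁·E₃ + Ew·E₁·ε₃ + εw·E₁·E₃)·Zl(d+1)(κ₀∕(4(d+1)))·e^{−(κ₀∕12)(‖z₁−z₀‖∞+‖z₃−z₀‖∞)}`. -/
theorem abs_refine3_le (hL : 1 ≤ L) (hN : 1 ≤ N) (hN' : N' = L * N) (hκ : 0 < κ₀)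
    (hEw : 0 ≤ Ew) (hE₁ : 0 ≤ E₁) (hE₃ : 0 ≤ E₃) (hεw : 0 ≤ εw) (hε₁ : 0 ≤ ε₁) (hε₃ : 0 ≤ ε₃)
    (hW' : ∀ κ x, |W' κ x| ≤ Ew * Real.exp (-(κ₀ * supNorm (quo N' x - z₀))))
    (hM' : ∀ κ x, |M' κ x| ≤ E₃ * Real.exp (-(κ₀ * supNorm (quo N' x - z₃))))
    (hW : ∀ κ c, |W κ c| ≤ Ew * Real.exp (-(κ₀ * supNorm (quo N c - z₀))))
    (hT : ∀ κ c, |T κ c| ≤ E₁ * Real.exp (-(κ₀ * supNorm (quo N c - z₁))))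
    (hM : ∀ κ c, |M κ c| ≤ E₃ * Real.exp (-(κ₀ * supNorm (quo N c - z₃))))
    (hdT : ∀ κ x, |T' κ x - T κ (quo L x)| ≤ ε₁ * Real.exp (-(κ₀ * supNorm (quo N' x - z₁))))
    (hdM : ∀ κ x, |M' κ x - M κ (quo L x)| ≤ ε₃ * Real.exp (-(κ₀ * supNorm (quo N' x - z₃))))
    (hdW : ∀ κ x, |W' κ x - W κ (quo L x)| ≤ εw * Real.exp (-(κ₀ * supNorm (quo N' x - z₀)))) :
    (Summable fun x : Site (d + 1) => ∑ κ, W' κ x * T' κ x * M' κ x) ∧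
    (Summable fun c : Site (d + 1) => ∑ κ, W κ c * T κ c * M κ c) ∧
    |((N' : ℝ) ^ (d + 1))⁻¹ * ∑' x, ∑ κ, W' κ x * T' κ x * M' κ x -
        ((N : ℝ) ^ (d + 1))⁻¹ * ∑' c, ∑ κ, W κ c * T κ c * M κ c| ≤
      ((d : ℝ) + 1) * (Ew * ε₁ * E₃ + Ew * E₁ * ε₃ + εw * E₁ * E₃) *
        (Zl (d + 1) (κ₀ / (4 * ((d : ℝ) + 1))) * Real.exp (-(κ₀ / 12) * (supNorm (z₁ - z₀) + supNorm (z₃ - z₀)))) := by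
  have hN'1 : 1 ≤ N' := by rw [hN']; exact Nat.le_mul_of_pos_right L hN |>.trans' hL
  -- the tower-k envelopes read on fine′
  have hq : ∀ x : Site (d + 1), quo N (quo L x) = quo N' x := fun x => quo_quo' hN' x
  have hTq : ∀ κ x, |T κ (quo L x)| ≤ E₁ * Real.exp (-(κ₀ * supNorm (quo N' x - z₁))) := fun κ x => by
    have h := hT κ (quo L x); rwa [hq] at h
  have hMq : ∀ κ x, |M κ (quo L x)| ≤ E₃ * Real.exp (-(κ₀ * supNorm (quo N' x - z₃))) := fun κ x => by
    have h := hM κ (quo L x); rwa [hq] at h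
  -- the three one-difference terms, counted on the fine′ lattice at blocking N′
  obtain ⟨hsA, hA⟩ := abs_tsum_weight_mul_mul_le (d := d) hN'1 hκ (w := W') (T := fun κ x => T' κ x - T κ (quo L x)) (M := M')
    (z₀ := z₀) (z₁ := z₁) (z₃ := z₃) hEw hε₁ hE₃ hW' hdT hM'
  obtain ⟨hsB, hB⟩ := abs_tsum_weight_mul_mul_le (d := d) hN'1 hκ (w := W') (T := fun κ x => T κ (quo L x))
    (M := fun κ x => M' κ x - M κ (quo L x)) (z₀ := z₀) (z₁ := z₁) (z₃ := z₃) hEw hE₁ hε₃ hW' hTq hdM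
  obtain ⟨hsC, hC⟩ := abs_tsum_weight_mul_mul_le (d := d) hN'1 hκ (w := fun κ x => W' κ x - W κ (quo L x))
    (T := fun κ x => T κ (quo L x)) (M := fun κ x => M κ (quo L x)) (z₀ := z₀) (z₁ := z₁) (z₃ := z₃) hεw hE₁ hE₃ hdW hTq hMq
  -- the tower-k pairing and its reading
  obtain ⟨hsP, -⟩ := abs_tsum_weight_mul_mul_le (d := d) hN hκ (w := W) (T := T) (M := M) (z₀ := z₀) (z₁ := z₁) (z₃ := z₃)
    hEw hE₁ hE₃ hW hT hM
  have hsPq : Summable fun x : Site (d + 1) => ∑ κ, W κ (quo L x) * T κ (quo L x) * M κ (quo L x) :=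
    summable_comp_quo' (g := fun c => ∑ κ, W κ c * T κ c * M κ c) hL hsP
  have hread : ((N' : ℝ) ^ (d + 1))⁻¹ * ∑' x : Site (d + 1), ∑ κ, W κ (quo L x) * T κ (quo L x) * M κ (quo L x)
      = ((N : ℝ) ^ (d + 1))⁻¹ * ∑' c : Site (d + 1), ∑ κ, W κ c * T κ c * M κ c :=
    units_refine (g := fun c => ∑ κ, W κ c * T κ c * M κ c) hL hN hN' hsP
  -- the pointwise split, weight last
  have hsplit : ∀ x : Site (d + 1), ∑ κ, W' κ x * T' κ x * M' κ x =
      ((∑ κ, W' κ x * (T' κ x - T κ (quo L x)) * M' κ x) + ∑ κ, W' κ x * T κ (quo L x) * (M' κ x - M κ (quo L x))) +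
        (∑ κ, (W' κ x - W κ (quo L x)) * T κ (quo L x) * M κ (quo L x)) +
        ∑ κ, W κ (quo L x) * T κ (quo L x) * M κ (quo L x) := by
    intro x
    rw [← Finset.sum_add_distrib, ← Finset.sum_add_distrib, ← Finset.sum_add_distrib]
    exact Finset.sum_congr rfl fun κ _ => by ring
  have hsF : Summable fun x : Site (d + 1) => ∑ κ, W' κ x * T' κ x * M' κ x :=
    (((hsA.add hsB).add hsC).add hsPq).congr fun x => (hsplit x).symm
  refine ⟨hsF, hsP, ?_⟩
  set A : ℝ := ∑' x : Site (d + 1), ∑ κ, W' κ x * (T' κ x - T κ (quo L x)) * M' κ x with hAdef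
  set B : ℝ := ∑' x : Site (d + 1), ∑ κ, W' κ x * T κ (quo L x) * (M' κ x - M κ (quo L x)) with hBdef
  set C : ℝ := ∑' x : Site (d + 1), ∑ κ, (W' κ x - W κ (quo L x)) * T κ (quo L x) * M κ (quo L x) with hCdef
  set Pq : ℝ := ∑' x : Site (d + 1), ∑ κ, W κ (quo L x) * T κ (quo L x) * M κ (quo L x) with hPqdef
  set ZE : ℝ := Zl (d + 1) (κ₀ / (4 * ((d : ℝ) + 1))) * Real.exp (-(κ₀ / 12) * (supNorm (z₁ - z₀) + supNorm (z₃ - z₀))) with hZE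
  have htsum : ∑' x : Site (d + 1), ∑ κ, W' κ x * T' κ x * M' κ x = A + B + C + Pq := by
    rw [tsum_congr hsplit, (((hsA.add hsB).add hsC).tsum_add hsPq), ((hsA.add hsB).tsum_add hsC), hsA.tsum_add hsB]
  have hN'pos : (0 : ℝ) < (N' : ℝ) ^ (d + 1) := by
    have : (0 : ℝ) < (N' : ℝ) := by exact_mod_cast (show 0 < N' by omega)
    positivity
  have e : ((N' : ℝ) ^ (d + 1))⁻¹ * (A + B + C + Pq) - ((N : ℝ) ^ (d + 1))⁻¹ * ∑' c : Site (d + 1), ∑ κ, W κ c * T κ c * M κ c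
      = ((N' : ℝ) ^ (d + 1))⁻¹ * (A + B + C) := by
    rw [← hread]; ring
  rw [htsum, e, abs_mul, abs_inv, abs_of_pos hN'pos]
  have habc : |A + B + C| ≤ ((d : ℝ) + 1) * (Ew * ε₁ * E₃ + Ew * E₁ * ε₃ + εw * E₁ * E₃) * ((N' : ℝ) ^ (d + 1) * ZE) := by
    have h3 := abs_add_three A B C
    have eq : ((d : ℝ) + 1) * (Ew * ε₁ * E₃ + Ew * E₁ * ε₃ + εw * E₁ * E₃) * ((N' : ℝ) ^ (d + 1) * ZE)
        = ((d : ℝ) + 1) * Ew * ε₁ * E₃ * ((N' : ℝ) ^ (d + 1) * ZE) + ((d : ℝ) + 1) * Ew * E₁ * ε₃ * ((N' : ℝ) ^ (d + 1) * ZE)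
          + ((d : ℝ) + 1) * εw * E₁ * E₃ * ((N' : ℝ) ^ (d + 1) * ZE) := by ring
    rw [eq]
    have hA' : |A| ≤ ((d : ℝ) + 1) * Ew * ε₁ * E₃ * ((N' : ℝ) ^ (d + 1) * ZE) := hA.trans (le_of_eq (by rw [hZE]; ring))
    have hB' : |B| ≤ ((d : ℝ) + 1) * Ew * E₁ * ε₃ * ((N' : ℝ) ^ (d + 1) * ZE) := hB.trans (le_of_eq (by rw [hZE]; ring))
    have hC' : |C| ≤ ((d : ℝ) + 1) * εw * E₁ * E₃ * ((N' : ℝ) ^ (d + 1) * ZE) := hC.trans (le_of_eq (by rw [hZE]; ring))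
    linarith
  calc ((N' : ℝ) ^ (d + 1))⁻¹ * |A + B + C|
      ≤ ((N' : ℝ) ^ (d + 1))⁻¹ * (((d : ℝ) + 1) * (Ew * ε₁ * E₃ + Ew * E₁ * ε₃ + εw * E₁ * E₃) * ((N' : ℝ) ^ (d + 1) * ZE)) :=
        mul_le_mul_of_nonneg_left habc (by positivity)
    _ = ((d : ℝ) + 1) * (Ew * ε₁ * E₃ + Ew * E₁ * ε₃ + εw * E₁ * E₃) * ZE := by
        field_simp

end Refine3

/-! ## §3 The jump count of a block-constant piece and of a staircase against two smooth factors -/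

section Jump

variable {N : ℕ} {κ₀ : ℝ} {z₀ z₁ z₃ : Site (d + 1)}

/-- NOT IN PRINT; OUR BOOKKEEPING.  **JUMP COUNT, ONE PIECE** (one lattice, blocking `N`, a scale `P ∣ N`): for a factor `Φ` under the PRODUCT of two block
envelopes (`|Φ κ u| ≤ A·E_{z₁}(u)·E_{z₃}(u)` — the two smooth factors of a Maxwell pairing, or one differenced letter times one smooth factor) and a piece
`g ∘ blk P` with `|g (blk P u)| ≤ B·E_{z₀}(u)`:
`|Σ'_u Σ_κ Φ κ u·(g(blk P (u + e_κ)) − g(blk P u))| ≤ (d+1)·2e^{κ₀}·A·B·P⁻¹·N^{d+1}·Zl(d+1)(κ₀∕(4(d+1)))·e^{−(κ₀∕12)(‖z₁−z₀‖∞+‖z₃−z₀‖∞)}`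
— the jump lives on the `P`-faces (the owner's (F1) `blk_add_unitVec_of_not_dvd`), which carry exactly `P⁻¹` of the three-envelope mass ((F2) `tsum_ite_dvd_eq`,
the envelopes being constant on the `P`-sub-blocks, `quo_zsmul_add_toSite_of_dvd`); one forward step costs `e^{κ₀}`. -/
theorem abs_tsum_mul_jump_blk_le (hN : 1 ≤ N) (hκ : 0 < κ₀) {P : ℕ} (hP : 1 ≤ P) (hPN : P ∣ N)
    {Φ : Form1 (d + 1) ℝ} {g : Form0 (d + 1) ℝ} {A B : ℝ} (hA : 0 ≤ A) (hB : 0 ≤ B)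
    (hΦ : ∀ κ u, |Φ κ u| ≤ A * (Real.exp (-(κ₀ * supNorm (quo N u - z₁))) * Real.exp (-(κ₀ * supNorm (quo N u - z₃)))))
    (hg : ∀ u, |g (blk P u)| ≤ B * Real.exp (-(κ₀ * supNorm (quo N u - z₀)))) :
    (Summable fun u : Site (d + 1) => ∑ κ, Φ κ u * (g (blk P (u + unitVec κ)) - g (blk P u))) ∧
    |∑' u : Site (d + 1), ∑ κ, Φ κ u * (g (blk P (u + unitVec κ)) - g (blk P u))| ≤
      ((d : ℝ) + 1) * (2 * Real.exp κ₀) * A * B * ((P : ℝ))⁻¹ *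
        ((N : ℝ) ^ (d + 1) * Zl (d + 1) (κ₀ / (4 * ((d : ℝ) + 1))) * Real.exp (-(κ₀ / 12) * (supNorm (z₁ - z₀) + supNorm (z₃ - z₀)))) := by
  haveI : NeZero N := ⟨by omega⟩
  have hκ' : 0 ≤ κ₀ := hκ.le
  have haff : ∀ κ : Fin (d + 1), AffineAveraging.unitVec κ = unitVec κ := fun κ => funext fun i => by
    rw [AffineAveraging.unitVec_apply, unitVec_apply]
  -- the three-envelope weight and its count
  set E : Site (d + 1) → ℝ := fun u => Real.exp (-(κ₀ * supNorm (quo N u - z₀))) * Real.exp (-(κ₀ * supNorm (quo N u - z₁))) *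
      Real.exp (-(κ₀ * supNorm (quo N u - z₃))) with hEdef
  obtain ⟨hEs, hEle⟩ := tsum_env3_le (d := d) hN hκ z₀ z₁ z₃
  have hE0 : ∀ u, 0 ≤ E u := fun u => by positivity
  have hconst : ∀ (w : Site (d + 1)) (r : Fin (d + 1) → ℕ), r ∈ box (d + 1) P → E ((P : ℤ) • w + toSite r) = E ((P : ℤ) • w) := by
    intro w r hr
    simp only [hEdef, quo_zsmul_add_toSite_of_dvd (N := N) hP hPN w hr]
  set K : ℝ := 2 * Real.exp κ₀ * A * B with hK
  have hK0 : 0 ≤ K := by positivity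
  -- per direction: pointwise bound by the face indicator, summability, face fraction
  have hdir : ∀ κ : Fin (d + 1),
      (Summable fun u : Site (d + 1) => Φ κ u * (g (blk P (u + unitVec κ)) - g (blk P u))) ∧
      |∑' u : Site (d + 1), Φ κ u * (g (blk P (u + unitVec κ)) - g (blk P u))| ≤ K * (((P : ℝ))⁻¹ * ∑' u, E u) := by
    intro κ
    have hpt : ∀ u, |Φ κ u * (g (blk P (u + unitVec κ)) - g (blk P u))| ≤ K * (if (P : ℤ) ∣ u κ + 1 then E u else 0) := by
      intro u
      by_cases hf : (P : ℤ) ∣ u κ + 1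
      · rw [if_pos hf]
        have h1 := hΦ κ u
        have h2 : |g (blk P (u + unitVec κ)) - g (blk P u)| ≤ 2 * Real.exp κ₀ * B * Real.exp (-(κ₀ * supNorm (quo N u - z₀))) := by
          have a1 := hg u
          have a2 : |g (blk P (u + unitVec κ))| ≤ B * (Real.exp κ₀ * Real.exp (-(κ₀ * supNorm (quo N u - z₀)))) := by
            have h := hg (u + unitVec κ)
            have w := env_add_unitVec_le (N := N) hκ' z₀ u κ
            rw [haff] at w
            exact h.trans (mul_le_mul_of_nonneg_left w hB)
          have a3 := abs_sub (g (blk P (u + unitVec κ))) (g (blk P u))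
          have hx : (1 : ℝ) ≤ Real.exp κ₀ := Real.one_le_exp hκ'
          have hpos : 0 ≤ B * Real.exp (-(κ₀ * supNorm (quo N u - z₀))) := by positivity
          nlinarith
        rw [abs_mul]
        calc |Φ κ u| * |g (blk P (u + unitVec κ)) - g (blk P u)|
            ≤ (A * (Real.exp (-(κ₀ * supNorm (quo N u - z₁))) * Real.exp (-(κ₀ * supNorm (quo N u - z₃))))) *
                (2 * Real.exp κ₀ * B * Real.exp (-(κ₀ * supNorm (quo N u - z₀)))) :=
              mul_le_mul h1 h2 (abs_nonneg _) (by positivity)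
          _ = K * E u := by rw [hK, hEdef]; ring
      · rw [if_neg hf]
        have hz : g (blk P (u + unitVec κ)) = g (blk P u) := by
          rw [← haff, blk_add_unitVec_of_not_dvd hP hf]
        rw [hz, sub_self, mul_zero, abs_zero, mul_zero]
    have hmaj : Summable fun u : Site (d + 1) => K * (if (P : ℤ) ∣ u κ + 1 then E u else 0) := by
      refine (Summable.of_nonneg_of_le (fun u => ?_) (fun u => ?_) hEs).mul_left K
      · split_ifs <;> [exact hE0 u; exact le_rfl]
      · split_ifs <;> [exact le_rfl; exact hE0 u]
    have hs : Summable fun u : Site (d + 1) => Φ κ u * (g (blk P (u + unitVec κ)) - g (blk P u)) :=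
      Summable.of_norm_bounded hmaj (fun u => by rw [Real.norm_eq_abs]; exact hpt u)
    refine ⟨hs, ?_⟩
    calc |∑' u : Site (d + 1), Φ κ u * (g (blk P (u + unitVec κ)) - g (blk P u))|
        ≤ ∑' u : Site (d + 1), |Φ κ u * (g (blk P (u + unitVec κ)) - g (blk P u))| := by
          have h := norm_tsum_le_tsum_norm hs.norm; simpa only [Real.norm_eq_abs] using h
      _ ≤ ∑' u : Site (d + 1), K * (if (P : ℤ) ∣ u κ + 1 then E u else 0) := hs.abs.tsum_le_tsum hpt hmaj
      _ = K * (((P : ℝ))⁻¹ * ∑' u, E u) := by rw [tsum_mul_left, tsum_ite_dvd_eq hP hEs hconst κ]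
  refine ⟨summable_sum fun κ _ => (hdir κ).1, ?_⟩
  rw [Summable.tsum_finsetSum fun κ _ => (hdir κ).1]
  calc |∑ κ, ∑' u : Site (d + 1), Φ κ u * (g (blk P (u + unitVec κ)) - g (blk P u))|
      ≤ ∑ κ, |∑' u : Site (d + 1), Φ κ u * (g (blk P (u + unitVec κ)) - g (blk P u))| := Finset.abs_sum_le_sum_abs _ _
    _ ≤ ∑ _κ : Fin (d + 1), K * (((P : ℝ))⁻¹ * ∑' u, E u) := Finset.sum_le_sum fun κ _ => (hdir κ).2
    _ = ((d : ℝ) + 1) * (K * (((P : ℝ))⁻¹ * ∑' u, E u)) := by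
        rw [Finset.sum_const, Finset.card_univ, Fintype.card_fin, nsmul_eq_mul]; push_cast; ring
    _ ≤ ((d : ℝ) + 1) * (K * (((P : ℝ))⁻¹ *
          ((N : ℝ) ^ (d + 1) * Zl (d + 1) (κ₀ / (4 * ((d : ℝ) + 1))) * Real.exp (-(κ₀ / 12) * (supNorm (z₁ - z₀) + supNorm (z₃ - z₀)))))) := by
        gcongr
    _ = _ := by rw [hK]; ring

/-- NOT IN PRINT; OUR BOOKKEEPING.  **JUMP COUNT, STAIRCASE**: for `g = Σ_{s ∈ range (k+1)} G s ∘ blk (P s)` with per-scale envelopes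
`|G s (blk (P s) u)| ≤ a s·E_{z₀}(u)`, every scale dividing the envelope block (`P s ∣ N`), and `Φ` under the product envelope `A·E_{z₁}E_{z₃}`:
`|Σ'_u Σ_κ Φ κ u·(g(u + e_κ) − g u)| ≤ (d+1)·2e^{κ₀}·A·(Σ_{s<k+1} a s·(P s)⁻¹)·N^{d+1}·Zl(d+1)(κ₀∕(4(d+1)))·e^{−(κ₀∕12)(‖z₁−z₀‖∞+‖z₃−z₀‖∞)}`.
Readings (PART 2 ∕ CT-4e): `P s = Lc^s`, `a s = α·Lc^s∕N` ⟹ weight `α(k+1)∕N` (tip-weight realignment: relatively `O((k+1)∕N)`); `P s = L·Lc^s` on the fine′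
lattice (the shorter tower's gauge staircase read through `quo L`) ⟹ the gradient-slot face term, weight `α(k+1)∕N′` against the unit gradient's `N′`: ONE LOG. -/
theorem abs_tsum_mul_jump_staircase_le (hN : 1 ≤ N) (hκ : 0 < κ₀) {k : ℕ} {P : ℕ → ℕ} (hP : ∀ s, s ≤ k → 1 ≤ P s)
    (hPN : ∀ s, s ≤ k → P s ∣ N) {Φ : Form1 (d + 1) ℝ} {G : ℕ → Form0 (d + 1) ℝ} {a : ℕ → ℝ} {A : ℝ} (hA : 0 ≤ A) (ha : ∀ s, 0 ≤ a s)
    (hΦ : ∀ κ u, |Φ κ u| ≤ A * (Real.exp (-(κ₀ * supNorm (quo N u - z₁))) * Real.exp (-(κ₀ * supNorm (quo N u - z₃)))))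
    (hG : ∀ s, s ≤ k → ∀ u, |G s (blk (P s) u)| ≤ a s * Real.exp (-(κ₀ * supNorm (quo N u - z₀))))
    {g : Form0 (d + 1) ℝ} (hg : ∀ u, g u = ∑ s ∈ Finset.range (k + 1), G s (blk (P s) u)) :
    (Summable fun u : Site (d + 1) => ∑ κ, Φ κ u * (g (u + unitVec κ) - g u)) ∧
    |∑' u : Site (d + 1), ∑ κ, Φ κ u * (g (u + unitVec κ) - g u)| ≤
      ((d : ℝ) + 1) * (2 * Real.exp κ₀) * A * (∑ s ∈ Finset.range (k + 1), a s * ((P s : ℝ))⁻¹) *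
        ((N : ℝ) ^ (d + 1) * Zl (d + 1) (κ₀ / (4 * ((d : ℝ) + 1))) * Real.exp (-(κ₀ / 12) * (supNorm (z₁ - z₀) + supNorm (z₃ - z₀)))) := by
  set ZE : ℝ := (N : ℝ) ^ (d + 1) * Zl (d + 1) (κ₀ / (4 * ((d : ℝ) + 1))) * Real.exp (-(κ₀ / 12) * (supNorm (z₁ - z₀) + supNorm (z₃ - z₀)))
    with hZE
  -- the piece pairings
  set F : ℕ → Site (d + 1) → ℝ := fun s u => ∑ κ, Φ κ u * (G s (blk (P s) (u + unitVec κ)) - G s (blk (P s) u)) with hF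
  have hpiece : ∀ s ∈ Finset.range (k + 1), Summable (F s) ∧
      |∑' u, F s u| ≤ ((d : ℝ) + 1) * (2 * Real.exp κ₀) * A * a s * ((P s : ℝ))⁻¹ * ZE := by
    intro s hs
    have hsk : s ≤ k := Nat.lt_succ_iff.1 (Finset.mem_range.1 hs)
    exact abs_tsum_mul_jump_blk_le (z₀ := z₀) (z₁ := z₁) (z₃ := z₃) hN hκ (hP s hsk) (hPN s hsk) hA (ha s) hΦ (hG s hsk)
  -- the pairing is the sum of the piece pairings
  have hsummand : ∀ u : Site (d + 1), ∑ κ, Φ κ u * (g (u + unitVec κ) - g u) = ∑ s ∈ Finset.range (k + 1), F s u := by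
    intro u
    rw [hF]; dsimp only
    rw [Finset.sum_comm]
    refine Finset.sum_congr rfl fun κ _ => ?_
    rw [hg (u + unitVec κ), hg u, ← Finset.sum_sub_distrib, Finset.mul_sum]
  have hsum : Summable fun u : Site (d + 1) => ∑ κ, Φ κ u * (g (u + unitVec κ) - g u) :=
    (summable_sum fun s hs => (hpiece s hs).1).congr fun u => (hsummand u).symm
  refine ⟨hsum, ?_⟩
  rw [tsum_congr hsummand, Summable.tsum_finsetSum fun s hs => (hpiece s hs).1]
  calc |∑ s ∈ Finset.range (k + 1), ∑' u, F s u| ≤ ∑ s ∈ Finset.range (k + 1), |∑' u, F s u| := Finset.abs_sum_le_sum_abs _ _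
    _ ≤ ∑ s ∈ Finset.range (k + 1), ((d : ℝ) + 1) * (2 * Real.exp κ₀) * A * a s * ((P s : ℝ))⁻¹ * ZE :=
        Finset.sum_le_sum fun s hs => (hpiece s hs).2
    _ = _ := by rw [Finset.mul_sum, Finset.sum_mul]; exact Finset.sum_congr rfl fun s _ => by ring

end Jump

end Summit.QuantumFields.BalabanUV.Beta.GAN24.ContactCellRefine

end
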